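import Summits.ValiantsHypothesis.ValiantsHypothesis.Theorems.LacunarySymmetroidMatrixDescartesKernelDefiniteJunctionWindows

/-!
# Kernel-definite junction, part 8b: reading coefficients off a scaling limit

Helper file for the stub `stub_kernelDefiniteJunction` of the line `junction_ceiling` (crux `MatrixDescartes`,
stmt-ValiantsHypothesis-18050).  Abstract polynomial bookkeeping (no matrices): if for every `v` the scaled sums
`z^{-M} ∑_{i ≤ I, j ≤ J} F i j v^j z^{w i + g (J − j)}` converge as `z → ∞` to `L v`, then
* `coeff_vanish_of_scaling_limit` — every coefficient ABOVE the critical line vanishes: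
  `w i + g (J − j) > M ⇒ F i j = 0`;
* `critical_sum_eq_of_scaling_limit` — ON the critical line the coefficients assemble to the limit:
  `∑_{w i + g (J − j) = M} F i j v^j = L v` for every `v`.
Tool: `coeff_of_tendsto_div_pow` — a real polynomial `p` with `p(z)/z^M → L` has no coefficient above `M` and
`[z^M] p = L` (Mathlib's `Polynomial.div_tendsto_*`). [folklore]
-/

-- `Summit.ValiantsHypothesis.ValiantsHypothesis.…` is the tree's mandated single-conjunct layout (Sub = Summit).
set_option linter.dupNamespace false
set_option autoImplicit false

namespace Summit.ValiantsHypothesis.ValiantsHypothesis.Theorems.LacunarySymmetroidMatrixDescartes.JunctionCeiling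

open Polynomial Finset Filter Topology
open scoped BigOperators

/-! ## 1. Coefficients from the growth at infinity -/

/-- If `p(z) / z^M → L` as `z → ∞` then `p` has no coefficient above `M` and `[z^M] p = L`. [folklore] -/
theorem coeff_of_tendsto_div_pow (p : ℝ[X]) (M : ℕ) (L : ℝ)
    (h : Tendsto (fun z : ℝ => p.eval z * (z ^ M)⁻¹) atTop (𝓝 L)) :
    (∀ k, M < k → p.coeff k = 0) ∧ p.coeff M = L := by
  have hQ : ((X : ℝ[X]) ^ M) ≠ 0 := pow_ne_zero _ X_ne_zero
  have hQdeg : ((X : ℝ[X]) ^ M).degree = (M : WithBot ℕ) := by rw [degree_X_pow]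
  have hQlead : ((X : ℝ[X]) ^ M).leadingCoeff = 1 := by rw [leadingCoeff_X_pow]
  have h' : Tendsto (fun z : ℝ => p.eval z / ((X : ℝ[X]) ^ M).eval z) atTop (𝓝 L) := by
    refine h.congr fun z => ?_
    rw [eval_pow, eval_X, div_eq_mul_inv]
  rcases lt_trichotomy p.degree ((X : ℝ[X]) ^ M).degree with hlt | heq | hgt
  · -- degree below `M`: the limit is `0`, and so are the coefficients `≥ M`
    have h0 := Polynomial.div_tendsto_atTop_zero_of_degree_lt p ((X : ℝ[X]) ^ M) hlt
    have hL : L = 0 := tendsto_nhds_unique h' h0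
    rw [hQdeg] at hlt
    have hcoeff : ∀ k, M ≤ k → p.coeff k = 0 := fun k hk =>
      coeff_eq_zero_of_degree_lt (hlt.trans_le (by exact_mod_cast hk))
    exact ⟨fun k hk => hcoeff k hk.le, by rw [hcoeff M le_rfl, hL]⟩
  · have h1 := Polynomial.div_tendsto_atTop_leadingCoeff_div_of_degree_eq p ((X : ℝ[X]) ^ M) heq
    rw [hQlead, div_one] at h1
    have hL : L = p.leadingCoeff := tendsto_nhds_unique h' h1
    have hnat : p.natDegree = M := natDegree_eq_of_degree_eq_some (heq.trans hQdeg)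
    refine ⟨fun k hk => coeff_eq_zero_of_natDegree_lt (hnat ▸ hk), ?_⟩
    rw [hL, leadingCoeff, hnat]
  · exfalso
    rcases le_or_gt 0 (p.leadingCoeff / ((X : ℝ[X]) ^ M).leadingCoeff) with hnn | hneg
    · exact not_tendsto_atTop_of_tendsto_nhds h'
        (Polynomial.div_tendsto_atTop_of_degree_gt p _ hgt hQ hnn)
    · exact not_tendsto_atBot_of_tendsto_nhds h'
        (Polynomial.div_tendsto_atBot_of_degree_gt p _ hgt hQ hneg.le)

/-- Coefficients of a double sum of monomials with an arbitrary exponent map. [folklore] -/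
theorem coeff_family' (G : ℕ → ℕ → ℝ) (ε : ℕ → ℕ → ℕ) (I J k : ℕ) :
    (∑ i ∈ range (I + 1), ∑ j ∈ range (J + 1), C (G i j) * X ^ (ε i j) : ℝ[X]).coeff k =
      ∑ i ∈ range (I + 1), ∑ j ∈ range (J + 1), if k = ε i j then G i j else 0 := by
  rw [finsetSum_coeff]
  refine Finset.sum_congr rfl fun i _ => ?_
  rw [finsetSum_coeff]
  refine Finset.sum_congr rfl fun j _ => ?_
  rw [coeff_C_mul_X_pow]

/-- On a line `k = w i + g (J − j)` (`w > 0`) each `j` carries at most one point: the `j`-th coefficient of the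
collecting polynomial `∑ [k = w i' + g (J − j')] F i' j' X^{j'}` is `F i j`. [folklore] -/
theorem coeff_critical (F : ℕ → ℕ → ℝ) (I J w g k : ℕ) (hw : 0 < w) (i j : ℕ) (hi : i ≤ I) (hj : j ≤ J)
    (hk : k = w * i + g * (J - j)) :
    (∑ i' ∈ range (I + 1), ∑ j' ∈ range (J + 1),
        C (if k = w * i' + g * (J - j') then F i' j' else 0) * X ^ j' : ℝ[X]).coeff j = F i j := by
  rw [coeff_family' (fun i' j' => if k = w * i' + g * (J - j') then F i' j' else 0) (fun _ j' => j') I J j,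
    Finset.sum_eq_single_of_mem i (mem_range.2 (Nat.lt_succ_of_le hi))]
  · rw [Finset.sum_eq_single_of_mem j (mem_range.2 (Nat.lt_succ_of_le hj))]
    · rw [if_pos rfl, if_pos hk]
    · intro j' _ hj'
      exact if_neg (Ne.symm hj')
  · intro i' _ hi'
    refine Finset.sum_eq_zero fun j' _ => ?_
    by_cases hjj : j = j'
    · rw [if_pos hjj, if_neg]
      intro h2
      rw [hk, ← hjj] at h2
      have : w * i = w * i' := by omega
      exact hi' (Nat.eq_of_mul_eq_mul_left hw this).symm
    · exact if_neg hjj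

/-! ## 2. The two consequences of a scaling limit -/

section Scaling

variable (F : ℕ → ℕ → ℝ) (I J w g M : ℕ) (L : ℝ → ℝ)
  (hlim : ∀ v : ℝ, Tendsto (fun z : ℝ =>
    (∑ i ∈ range (I + 1), ∑ j ∈ range (J + 1), F i j * v ^ j * z ^ (w * i + g * (J - j))) * (z ^ M)⁻¹)
      atTop (𝓝 (L v)))

include hlim

/-- for each `v`, the `z`-polynomial `∑ F i j v^j z^{w i + g (J − j)}` has no coefficient above `M` and its
`M`-th coefficient is `L v`. [folklore] -/
theorem zcoeff_of_scaling_limit (v : ℝ) :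
    (∀ k, M < k → (∑ i ∈ range (I + 1), ∑ j ∈ range (J + 1),
        if k = w * i + g * (J - j) then F i j * v ^ j else (0 : ℝ)) = 0) ∧
      (∑ i ∈ range (I + 1), ∑ j ∈ range (J + 1),
        if M = w * i + g * (J - j) then F i j * v ^ j else (0 : ℝ)) = L v := by
  set p : ℝ[X] := ∑ i ∈ range (I + 1), ∑ j ∈ range (J + 1),
    C (F i j * v ^ j) * X ^ (w * i + g * (J - j)) with hp
  have hev : ∀ z : ℝ, p.eval z =
      ∑ i ∈ range (I + 1), ∑ j ∈ range (J + 1), F i j * v ^ j * z ^ (w * i + g * (J - j)) := by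
    intro z
    rw [hp, eval_finsetSum]
    refine Finset.sum_congr rfl fun i _ => ?_
    rw [eval_finsetSum]
    refine Finset.sum_congr rfl fun j _ => ?_
    rw [eval_mul, eval_C, eval_pow, eval_X]
  have h := coeff_of_tendsto_div_pow p M (L v) ((hlim v).congr fun z => by rw [hev])
  refine ⟨fun k hk => ?_, ?_⟩
  · have := h.1 k hk
    rwa [hp, coeff_family'] at this
  · have := h.2
    rwa [hp, coeff_family'] at this

/-- **Above the critical line the coefficients vanish.** [folklore] -/
theorem coeff_vanish_of_scaling_limit (hw : 0 < w) (i j : ℕ) (hi : i ≤ I) (hj : j ≤ J)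
    (hk : M < w * i + g * (J - j)) : F i j = 0 := by
  -- the `v`-polynomial collecting the `z^k`-coefficient, `k = w i + g (J - j)`, vanishes identically
  set k : ℕ := w * i + g * (J - j) with hkdef
  set R : ℝ[X] := ∑ i' ∈ range (I + 1), ∑ j' ∈ range (J + 1),
    C (if k = w * i' + g * (J - j') then F i' j' else 0) * X ^ j' with hR
  have hR0 : R = 0 := by
    apply Polynomial.funext
    intro v
    rw [hR, eval_zero, eval_finsetSum]
    have h := (zcoeff_of_scaling_limit F I J w g M L hlim v).1 k hk
    refine Eq.trans (Finset.sum_congr rfl fun i' _ => ?_) h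
    rw [eval_finsetSum]
    refine Finset.sum_congr rfl fun j' _ => ?_
    rw [eval_mul, eval_C, eval_pow, eval_X]
    split_ifs
    · rfl
    · rw [zero_mul]
  -- its `j`-th coefficient is `F i j`
  have hcoeff : R.coeff j = F i j := by
    rw [hR]
    exact coeff_critical F I J w g k hw i j hi hj hkdef
  rw [← hcoeff, hR0, coeff_zero]

/-- **On the critical line the coefficients assemble to the limit.** [folklore] -/
theorem critical_sum_eq_of_scaling_limit (v : ℝ) :
    (∑ i ∈ range (I + 1), ∑ j ∈ range (J + 1),
        if M = w * i + g * (J - j) then F i j * v ^ j else (0 : ℝ)) = L v :=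
  (zcoeff_of_scaling_limit F I J w g M L hlim v).2

end Scaling

end Summit.ValiantsHypothesis.ValiantsHypothesis.Theorems.LacunarySymmetroidMatrixDescartes.JunctionCeiling
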